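/-
Copyright: statement-level skeleton of a published paper (lit-balaban cell, Phase-2 proof seat p25, gen 15). No proof
claims beyond what the kernel checks below.
-/
import Literature.MathematicalPhysics.QuantumFieldTheory.BalabanImbrieJaffe1984to88.BIJ88VertexExpansion311
import Literature.MathematicalPhysics.QuantumFieldTheory.BalabanImbrieJaffe1984to88.BIJ88WickDerivatives305

/-!
# `BalabanImbrieJaffe1984to88.BIJ88VertexExpansionWick311` — T. Bałaban, J. Imbrie, A. Jaffe, *Effective action and cluster
properties of the abelian Higgs model*, Commun. Math. Phys. **114** (1988) 257–315 [BalabanImbrieJaffe1988], §5.14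
p. 311–312 [PDF 55–56] *"Summing all possible diagrams in X_c gives the observable for the next step there,
F^L_{k+1,loc}(X_c)"* and §5.13 p. 305 [PDF 49] *"Each Φ contracts through a C_s to another Φ, to an f(□_i) or to ℱ"* —
**THE CONSTANT PART OF THE VERTEX EXPANSION: ITS RECURSION, AND ITS ZEROTH ORDER IN THE INTERACTION IS THE COMPLETE
WICK CONTRACTION**: the constant part `cst` (= `F^L`, all complete contraction diagrams with at most `m̄` vertices) of p25
gen 15's `BIJ88VertexExpansion311.terms` obeys the one-step recursion of the expansion (`cst_cons_zero/succ`: pair with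
another leg, contract to the source, or — with budget left — differentiate down a vertex), and WITHOUT INTERACTION VERTICES
it is exactly p13's complete contraction sum `Σ_{σ ∈ smallParts T} Π_{B∈σ} w_B` of `BIJ88WickSource305.wick_source` /
p25 gen 14's `BIJ88WickDerivatives305.wick_smooth` (pairs `⟨Cv_i,v_j⟩`, source singletons `⟨Cv_i,ℱ⟩`) — the row owner's
reading (b′) *"F^L(X_c) of [gen 14] = the ZEROTH ORDER IN THE INTERACTION of print's F^L_{k+1,loc}(X_c)"* kernel-checked.

statement-level skeleton of published theorems with citation tags; proofs where landed; nothing here is a claim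
about the Yang–Mills mass gap

PDF held: `paper:balaban1988-cmp114-bij-abelian-higgs-effective-action` (journal page = PDF page + 256); p. 305, 311–312 =
PDF 49, 55–56.

CITATION HEADER (lean-in-tree rule).  lit-balaban cell (HOME `run/shared/lean/pub/lit-balaban/`), Phase 2, seat p25
gen 15; row **C2.Claim@312** of `HOME/lit-balaban-r16/ROWS-C2-part2.md` (owner r16, referee ref-5; head untouched).
USED BY NAME, nothing restated: `BIJ88VertexExpansion311.{Term, Kind, terms, cst}`, p13's
`BIJ88PairingAllOrders5133.{smallParts, smallParts_empty}`, `BIJ88WickSource305.cweight`, p25 gen 14's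
`BIJ88WickDerivatives305.cT_insert`.

## What is proved (0 `sorry`, standard axioms, no new `Prop` facts; one definition with body `ccoef`)
* `ccoef` (the constant coefficient of a term), `cst_eq_sum_ccoef`, `cst_nil`, **`cst_cons_zero`** / **`cst_cons_succ`**
  (THE RECURSION OF `F^L`: `F^L(u::L, 0) = Σ_i⟨Cu,L_i⟩F^L(L∖i,0) + ⟨Cu,ℱ⟩F^L(L,0)`,
  `F^L(u::L, b+1) = Σ_i⟨Cu,L_i⟩F^L(L∖i,b+1) + ⟨Cu,ℱ⟩F^L(L,b+1) + Σ_mΣ_j(−c_m⟨Cu,(legs m)_j⟩)F^L(L++(legs m∖j), b)`),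
  `cst_cons_of_isEmpty`;
* **`cst_sort_eq_sum_smallParts`** — NO VERTICES (`ι` empty): for labelled legs `v : κ → (S → ℝ)` and `T : Finset κ`,
  `cst ((T.sort ≤).map v) b = Σ_{σ∈smallParts T} Π_{B∈σ} cweight A ℱ v B` for every budget `b`.
HONEST SCOPE: combinatorial identities only; one component as in `BIJ88VertexExpansion311`.  NOT summit progress; NOT
continuum; NOT Clay.  Imports `BIJ88VertexExpansion311` (p25 gen 15) and `BIJ88WickDerivatives305` (p25 gen 14); modifies
nothing.
-/

noncomputable section

namespace Literature.MathematicalPhysics.QuantumFieldTheory.BalabanImbrieJaffe1984to88.BIJ88VertexExpansionWick311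

open MeasureTheory Matrix Finset
open scoped BigOperators
open Literature.MathematicalPhysics.QuantumFieldTheory.Balaban1983to89
open BIJ88PairingAllOrders5133 (smallParts smallParts_empty)
open BIJ88WickSource305 (cweight)
open BIJ88WickDerivatives305 (cT_insert)
open BIJ88VertexExpansion311 (Kind Term terms cst)

variable {S : Type} [Fintype S] {ι : Type} [Fintype ι]

/-! ## §1  The constant coefficient of a term and the recursion of `F^L` -/

/-- The constant coefficient of a term: its coefficient if it is a `const` term (all legs contracted, no `χ′`, within
the vertex budget), `0` otherwise. [cite: BalabanImbrieJaffe1988, §5.14 p.312] -/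
def ccoef (t : Term S) : ℝ := match t.kind with
  | .const => t.coef
  | _ => 0

omit [Fintype S] in
/-- Scaling scales the constant coefficient. [cite: BalabanImbrieJaffe1988, §5.14 p.312] -/
theorem ccoef_scale (a : ℝ) (t : Term S) : ccoef (t.scale a) = a * ccoef t := by
  unfold ccoef
  rcases t with ⟨co, pe, k, n⟩
  rcases k with _ | z | _ <;> simp [Term.scale]

omit [Fintype S] in
/-- The vertex count does not affect the constant coefficient. [cite: BalabanImbrieJaffe1988, §5.14 p.312] -/
theorem ccoef_bump (t : Term S) : ccoef t.bump = ccoef t := by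
  unfold ccoef
  rcases t with ⟨co, pe, k, n⟩
  rcases k with _ | z | _ <;> simp [Term.bump]

omit [Fintype S] in
/-- Total constant coefficient of scaled terms. [cite: BalabanImbrieJaffe1988, §5.14 p.312] -/
theorem sum_ccoef_scale (a : ℝ) : ∀ ts : List (Term S),
    ((ts.map (Term.scale a)).map ccoef).sum = a * (ts.map ccoef).sum
  | [] => by simp
  | t :: ts => by simp only [List.map_cons, List.sum_cons, ccoef_scale, sum_ccoef_scale a ts, mul_add]

omit [Fintype S] in
/-- Total constant coefficient of scaled, bumped terms. [cite: BalabanImbrieJaffe1988, §5.14 p.312] -/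
theorem sum_ccoef_scale_bump (a : ℝ) : ∀ ts : List (Term S),
    ((ts.map fun t => (t.scale a).bump).map ccoef).sum = a * (ts.map ccoef).sum
  | [] => by simp
  | t :: ts => by
    simp only [List.map_cons, List.sum_cons, ccoef_bump, ccoef_scale, sum_ccoef_scale_bump a ts, mul_add]

omit [Fintype S] [Fintype ι] in
/-- Sums over a `flatMap` are iterated sums. [folklore] -/
private theorem sum_map_flatMap {α β : Type} (l : List α) (g : α → List β) (h : β → ℝ) :
    ((l.flatMap g).map h).sum = (l.map fun a => ((g a).map h).sum).sum := by
  induction l with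
  | nil => simp
  | cons a l ih => simp [List.flatMap_cons, List.map_append, List.sum_append, ih]

variable [DecidableEq S] (A : Matrix S S ℝ) (f : S → ℝ) (c : ι → ℝ) (legs : ι → List (S → ℝ))

/-- `F^L` is the total constant coefficient. [cite: BalabanImbrieJaffe1988, §5.14 p.312] -/
theorem cst_eq_sum_ccoef (L : List (S → ℝ)) (b : ℕ) :
    cst A f c legs L b = ((terms A f c legs L b).map ccoef).sum := by
  unfold cst
  exact congrArg List.sum (List.map_congr_left fun t _ => by unfold ccoef; rcases t.kind with _ | z | _ <;> rfl)

/-- No legs: `F^L = 1`. [cite: BalabanImbrieJaffe1988, §5.14 p.312] -/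
theorem cst_nil (b : ℕ) : cst A f c legs [] b = 1 := by
  rw [cst_eq_sum_ccoef, terms]
  simp [ccoef]

/-- **The recursion of `F^L`, budget exhausted**: the head leg pairs with another leg or contracts to the source (a
`χ′`-hit or one more vertex makes the term a remainder term). [cite: BalabanImbrieJaffe1988, §5.14 p.311–312] -/
theorem cst_cons_zero (u : S → ℝ) (L : List (S → ℝ)) :
    cst A f c legs (u :: L) 0
      = (∑ i ∈ range L.length, ((A⁻¹ *ᵥ u) ⬝ᵥ L.getD i 0) * cst A f c legs (L.eraseIdx i) 0)
        + ((A⁻¹ *ᵥ u) ⬝ᵥ f) * cst A f c legs L 0 := by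
  simp only [cst_eq_sum_ccoef]
  rw [terms]
  simp only [List.map_append, List.sum_append, List.map_cons, List.map_nil, List.sum_cons, List.sum_nil, add_zero,
    sum_map_flatMap, sum_ccoef_scale, Finset.sum_map_toList]
  have h0 : ∀ m ∈ (univ : Finset ι), ∑ j ∈ range (legs m).length,
      ccoef (⟨-(c m * ((A⁻¹ *ᵥ u) ⬝ᵥ (legs m).getD j 0)), L ++ (legs m).eraseIdx j, .cap, 1⟩ : Term S) = 0 :=
    fun m _ => sum_eq_zero fun j _ => rfl
  rw [sum_congr rfl h0, sum_const_zero, add_zero, show ccoef (⟨1, L, .dchi (A⁻¹ *ᵥ u), 0⟩ : Term S) = 0 from rfl,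
    add_zero]

/-- **The recursion of `F^L`, budget left**: the head leg pairs, contracts to the source, or differentiates down a vertex
whose other legs join the pending ones (budget decreases). [cite: BalabanImbrieJaffe1988, §5.14 p.311–312] -/
theorem cst_cons_succ (u : S → ℝ) (L : List (S → ℝ)) (b : ℕ) :
    cst A f c legs (u :: L) (b + 1)
      = (∑ i ∈ range L.length, ((A⁻¹ *ᵥ u) ⬝ᵥ L.getD i 0) * cst A f c legs (L.eraseIdx i) (b + 1))
        + ((A⁻¹ *ᵥ u) ⬝ᵥ f) * cst A f c legs L (b + 1)
        + ∑ m, ∑ j ∈ range (legs m).length, (-(c m * ((A⁻¹ *ᵥ u) ⬝ᵥ (legs m).getD j 0))) *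
            cst A f c legs (L ++ (legs m).eraseIdx j) b := by
  simp only [cst_eq_sum_ccoef]
  rw [terms]
  simp only [List.map_append, List.sum_append, List.map_cons, List.map_nil, List.sum_cons, List.sum_nil, add_zero,
    sum_map_flatMap, sum_ccoef_scale, sum_ccoef_scale_bump, Finset.sum_map_toList]
  rw [show ccoef (⟨1, L, .dchi (A⁻¹ *ᵥ u), 0⟩ : Term S) = 0 from rfl, add_zero]

/-- **Without interaction vertices** (`ι` empty) the recursion has only the pairing and source alternatives, for every
budget. [cite: BalabanImbrieJaffe1988, §5.13 p.305] -/
theorem cst_cons_of_isEmpty [IsEmpty ι] (u : S → ℝ) (L : List (S → ℝ)) (b : ℕ) :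
    cst A f c legs (u :: L) b
      = (∑ i ∈ range L.length, ((A⁻¹ *ᵥ u) ⬝ᵥ L.getD i 0) * cst A f c legs (L.eraseIdx i) b)
        + ((A⁻¹ *ᵥ u) ⬝ᵥ f) * cst A f c legs L b := by
  cases b with
  | zero => exact cst_cons_zero A f c legs u L
  | succ b => rw [cst_cons_succ, Finset.univ_eq_empty, sum_empty, add_zero]

/-! ## §2  Zeroth order in the interaction = the complete Wick contraction -/

section Zeroth

variable {κ : Type} [LinearOrder κ]

omit [Fintype S] [Fintype ι] [DecidableEq S] in
/-- Erasing the `i`-th element of the sorted list of a finite set gives the sorted list of the set minus that element.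
[folklore] -/
private theorem sort_erase_eq_eraseIdx (t : Finset κ) {i : ℕ} (hi : i < (t.sort (· ≤ ·)).length) :
    (t.erase ((t.sort (· ≤ ·))[i])).sort (· ≤ ·) = (t.sort (· ≤ ·)).eraseIdx i := by
  have hnd : (t.sort (· ≤ ·)).Nodup := Finset.sort_nodup (r := (· ≤ ·)) t
  refine List.Perm.eq_of_sortedLE ((Finset.pairwise_sort (r := (· ≤ ·)) _).sortedLE)
    (((Finset.pairwise_sort (r := (· ≤ ·)) t).sublist (List.eraseIdx_sublist _ _)).sortedLE) ?_
  refine List.perm_of_nodup_nodup_toFinset_eq (Finset.sort_nodup (r := (· ≤ ·)) _)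
    (hnd.sublist (List.eraseIdx_sublist _ _)) ?_
  rw [Finset.sort_toFinset, ← hnd.erase_getElem i hi]
  ext y
  simp only [Finset.mem_erase, List.mem_toFinset, hnd.mem_erase_iff, Finset.mem_sort, ne_eq]

omit [Fintype S] [Fintype ι] [DecidableEq S] in
/-- `Σ_{i<|l|} g(l_i) = Σ_{x∈l} g(x)`. [folklore] -/
private theorem sum_range_getD {X : Type} (g : X → ℝ) (d : X) :
    ∀ l : List X, ∑ i ∈ range l.length, g (l.getD i d) = (l.map g).sum
  | [] => by simp
  | x :: l => by
    rw [List.length_cons, sum_range_succ', List.map_cons, List.sum_cons, add_comm]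
    simp only [List.getD_cons_zero, List.getD_cons_succ, sum_range_getD g d l]

/-- **ZEROTH ORDER IN THE INTERACTION = THE COMPLETE WICK CONTRACTION** (*"Each Φ contracts through a C_s to another Φ
… or to ℱ"*): without interaction vertices, for labelled legs `v : κ → (S → ℝ)`, `T : Finset κ` and any budget `b`,
`F^L((T.sort ≤).map v, b) = Σ_{σ ∈ smallParts T} Π_{B∈σ} cweight A ℱ v B` — p13's complete contraction into pairs
`⟨Cv_i,v_j⟩` and source singletons `⟨Cv_i,ℱ⟩` (`wick_source`; p25 gen 14's `wick_smooth`, case `D = ∅`).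
[cite: BalabanImbrieJaffe1988, §5.13 p.305] [cite: BalabanImbrieJaffe1988, §5.14 p.312] -/
theorem cst_sort_eq_sum_smallParts [IsEmpty ι] (hA : A.PosDef) (v : κ → S → ℝ) (b : ℕ) (T : Finset κ) :
    cst A f c legs ((T.sort (· ≤ ·)).map v) b = ∑ σ ∈ smallParts T, ∏ B ∈ σ, cweight A f v B := by
  induction T using Finset.strongInduction with
  | H T ih =>
    rcases T.eq_empty_or_nonempty with hT | hne
    · subst hT
      simp [cst_nil, smallParts_empty]
    · have ha : T.min' hne ∈ T := min'_mem T hne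
      set a := T.min' hne with ha_def
      set t := T.erase a with ht_def
      have hat : a ∉ t := notMem_erase a T
      have hTt : insert a t = T := insert_erase ha
      have hlt : ∀ x ∈ t, a ≤ x := fun x hx => ha_def ▸ min'_le T x (mem_of_mem_erase hx)
      have htT : t ⊂ T := erase_ssubset ha
      rw [← hTt, Finset.sort_insert (r := (· ≤ ·)) hlt hat, List.map_cons, cst_cons_of_isEmpty,
        cT_insert hA f v hat, ih t htT, add_comm]
      congr 1
      -- reindex the pairing alternatives by the elements of `t`
      set l := t.sort (· ≤ ·) with hl
      have hnd : l.Nodup := Finset.sort_nodup (r := (· ≤ ·)) t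
      have hlen : (l.map v).length = l.length := List.length_map _
      have hsum : ∀ i ∈ range (l.map v).length,
          ((A⁻¹ *ᵥ v a) ⬝ᵥ (l.map v).getD i 0) * cst A f c legs ((l.map v).eraseIdx i) b
            = (fun x => ((A⁻¹ *ᵥ v a) ⬝ᵥ v x) * ∑ σ ∈ smallParts (t.erase x), ∏ B ∈ σ, cweight A f v B)
                (l.getD i a) := fun i hi => by
        have hi' : i < l.length := by simpa [hlen] using hi
        have hx : l.getD i a = l[i] := List.getD_eq_getElem _ _ hi'
        have hxt : l[i] ∈ t := (Finset.mem_sort (r := (· ≤ ·))).1 (List.getElem_mem hi')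
        have hsub : t.erase l[i] ⊂ T := (erase_ssubset hxt).trans htT
        dsimp only
        rw [List.getD_eq_getElem _ _ (by simpa [hlen] using hi), List.getElem_map, List.eraseIdx_map,
          ← sort_erase_eq_eraseIdx t hi', ih (t.erase l[i]) hsub, hx]
      rw [sum_congr rfl hsum, hlen,
        sum_range_getD (fun x => ((A⁻¹ *ᵥ v a) ⬝ᵥ v x) * ∑ σ ∈ smallParts (t.erase x), ∏ B ∈ σ, cweight A f v B) a l,
        ← List.sum_toFinset _ hnd, Finset.sort_toFinset]

end Zeroth

end Literature.MathematicalPhysics.QuantumFieldTheory.BalabanImbrieJaffe1984to88.BIJ88VertexExpansionWick311
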